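import Summits.QuantumFields.YangMills.Theorems.UnitScaleTiltProp7ProjRangeKernelDecayCoarseGram
import Summits.QuantumFields.YangMills.Theorems.UnitScaleTiltProp7AccretiveConjOperatorBound
import HarnessLib

/-!
# Route `UnitScaleTilt`, crux K1 «MinimiserStabilityRegPr» (stmt-QuantumFields-19200), EX row `hGF[Lift]` (curved member) — **LOD LINE BRICK (L5′-member), ABSTRACT LAYER
# (routeR-w2 g12, LOCATE-L5-GRAMSHELLS 7416633c): THE COARSE GRAM OPERATOR `M = BᴴB` OF WEIGHTED-LOCALISED COLUMNS HAS EXPONENTIALLY DECAYING ENTRIES (weighted Cauchy–Schwarz,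
# rate `μ`, no volume constant) AND AN EXPONENTIALLY DECAYING INVERSE BY AGMON ON THE COARSE LATTICE — `M_φ = B̃₋ᴴB̃₊` is accretive as soon as the two weighted columns
# operators `B̃_± = e^{±ψ}Be^{∓φ}` are `ε`-close to `B` with `3ε² < m₀∕2`.**

Cell `ym3-torus` (HUMAN RULING D-0037, YM ladder rung R3 — NOT d = 4, NOT infinite volume, NOT a mass gap, NOT Clay).  Width seat `ym-routeR-w2` gen 12 (D-0154 (3c); chair ★p1 g24
22:12:46Z (4) «(L5′-member) GRAM SHELLS»; ★★OWNER RULINGS №33∕№35).  THEOREMS ONLY (0 `def`, 0 `sorry`), Mathlib + ✓`Prop7ProjRangeKernelDecayCoarseGram` (`accretive_gram_of_coercive`)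
+ ✓`Prop7AccretiveConjOperatorBound` (`re_sum_star_mul_le`, `weighted_sum_normSq_inv_mulVec_le_of_conj_accretive`); `--supports stmt-QuantumFields-19200 --as helper`, count-neutral.
HONEST LABEL (№33 (6)): curved γ-row supplier line (LOD localisation), abstract coarse-lattice algebra; CONDITIONAL at the member on (L3′a) (the weighted-L² Agmon rows of
`G_a = (Δ_U + aQ″†Q″)⁻¹`), (L4′)∕(BUMP) (the coarse coercivity `m₀`); nothing of (3.49), Thm 3.1∕3.3, `h349`, `hGF`, EX ∕ 19200 is proved here.

WHY (LOCATE-L5-GRAMSHELLS §(ii) (M1)–(M2)).  Print's complementary gauge projector is `P = B M⁻¹ Bᴴ` with `B = G_aQ″†` (coarse → fine) and the coarse Gram operator `M = BᴴB`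
(✓`Prop7LODProjectorGlue`, ✓`Prop7ProjRangeKernelDecayCoarseGram` §2); the block-to-block decay of `P, DP, PD*, DPD*` is ✓`Prop7GramSandwichBlockBound.norm_form_sandwich_le_exp` once
(a) the column block norms of `B` decay — (L3′a) — and (b) `‖M⁻¹ y y′‖ ≤ C_N e^{−μ′ dc(y,y′)}`.  For (b) the Schur-budget Combes–Thomas ✓`gram_inv_decay` is K-uniform but, at the line's
constants of record (`m = 1∕16`, `μ ≈ 0.047`, `‖M y y′‖ ≲ (2q∕m)²e^{−μ dc}`), forces `μ′ ≲ 10⁻⁹·m₀` (memo (M2) road (S)); the AGMON road (memo road (G)) keeps a polynomial rate: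
conjugate `M` by a coarse weight `e^{φ}`, insert a fine weight `e^{ψ}` between the two factors of `BᴴB`,
    `Σ_{a,b} c̄_a e^{φ_a − φ_b} M_{ab} c_b = Σ_x conj((B̃₋c)_x)·(B̃₊c)_x`,   `B̃₊ := e^{ψ}Be^{−φ}`, `B̃₋ := e^{−ψ}Be^{φ}`   (§2 `conj_gram_form_eq`),
and absorb the column perturbations `‖(B̃_± − B)c‖ ≤ ε‖c‖` (at the member: the resolvent identity for `e^{ψ}G_ae^{−ψ} − G_a` over (L3′a) + the in-block oscillation `e^{3μ″} − 1` of
`ψ` against `φ∘blk`) quadratically: `Re ≥ ½‖Bc‖² − 3ε²‖c‖² ≥ (m₀∕2 − 3ε²)‖c‖²` (§2 `re_conj_gram_ge`).  Then ✓p747790's Agmon bound applies to `A := M` verbatim (§3).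

WHAT IS PROVED (ns `Summit.QuantumFields.YangMills.Theorems.Prop7GramConjAccretive`; `B : Matrix n m ℂ`, `M = Bᴴ * B` as a defining hypothesis; `‖·‖₂²` written as sums).
* §1 ★ `gram_entry_decay_of_weighted_cols` — `Σ_x e^{2φ_y(x)}‖B x y‖² ≤ C_B²` for every column and `φ_y(x) + φ_{y′}(x) ≥ μ·dc(y,y′) − s` ⟹ `‖M y y′‖ ≤ C_B²·e^{s}·e^{−μ dc(y,y′)}`
  (rate `μ`, no block weight, no volume constant; compare ✓`gram_entry_decay`, which needs pointwise columns).
* §2 `conj_gram_form_eq` (the sandwich identity above), ★ `re_pairing_ge_of_perturbation` (`Re Σ conj(u+d₋)(u+d₊) ≥ ½‖u‖² − 3ε²` bookkeeping), ★★ `re_conj_gram_ge`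
  (`(m₀∕2 − 3ε²)·Σ‖c‖² ≤ Re Σ c̄ (M_φ c)` from `m₀`-coercivity of `B` and the two `ε`-perturbation rows).
* §3 ★★ `gram_inv_weighted_decay` (`Σ e^{2φ_y}‖(M⁻¹v)_y‖² ≤ (m₀∕2 − 3ε²)⁻²·Σ e^{2φ_y}‖v_y‖²`) and ★ `gram_inv_entry_decay` (`‖M⁻¹ y y′‖ ≤ (m₀∕2 − 3ε²)⁻¹·e^{−(φ_y − φ_{y′})}`,
  the `hN` input of ✓`norm_form_sandwich_le_exp` ∕ `hMinv` of ✓`P_decay` once `φ = μ″·dc(·, y′)`).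

References: S. Agmon, *Lectures on exponential decay of solutions of second-order elliptic equations* (1982) Ch. 1 [folklore]; T. Bałaban, CMP **99** (1985) 389–434
[Balaban1985BackgroundPropagators] ((3.21) p.394, Thm 3.1 (3.46) p.398, (3.49) p.399); CMP **116** (1988) 1–22 [Balaban1988RG2Cluster] ((2.7) p.13); A. Målqvist, D. Peterseim,
Math. Comp. **83** (2014) 2583–2603 [folklore].
-/

set_option autoImplicit false

noncomputable section

open scoped Matrix ComplexConjugate BigOperators
open Finset

namespace Summit.QuantumFields.YangMills.Theorems.Prop7GramConjAccretive

open Summit.QuantumFields.YangMills.Theorems.Prop7ProjRangeKernelDecayCoarseGram (accretive_gram_of_coercive)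
open Summit.QuantumFields.YangMills.Theorems.Prop7AccretiveConjOperatorBound (re_sum_star_mul_le weighted_sum_normSq_inv_mulVec_le_of_conj_accretive
  set_decay_of_conj_accretive)

variable {n m : Type*} [Fintype n] [Fintype m]

/-! ## §1 Weighted-localised columns give exponentially decaying Gram entries (weighted Cauchy–Schwarz) -/

omit [Fintype m] in
/-- ★ **GRAM ENTRY DECAY FROM WEIGHTED-`ℓ²` COLUMNS**: if every column of `B` satisfies the Agmon bound `Σ_x e^{2φ_y(x)}‖B x y‖² ≤ C_B²` and the weights of two columns add up to
`≥ μ·dc(y,y′) − s` pointwise, then `‖(BᴴB) y y′‖ ≤ C_B²·e^{s}·e^{−μ dc(y,y′)}` — Cauchy–Schwarz in `x`; no block weight, no volume constant, rate `μ`.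
[cite: Balaban1985BackgroundPropagators, Thm 3.1 (3.46) p.398] -/
theorem gram_entry_decay_of_weighted_cols (B : Matrix n m ℂ) {M : Matrix m m ℂ} (hM : M = Bᴴ * B) (φ : m → n → ℝ) (dc : m → m → ℝ) {CB μ s : ℝ}
    (hCB : 0 ≤ CB) (hB : ∀ y, ∑ x, Real.exp (φ y x) ^ 2 * ‖B x y‖ ^ 2 ≤ CB ^ 2) (hφ : ∀ y y' x, μ * dc y y' - s ≤ φ y x + φ y' x) (y y' : m) :
    ‖M y y'‖ ≤ CB ^ 2 * Real.exp s * Real.exp (-(μ * dc y y')) := by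
  rw [hM, Matrix.mul_apply]
  refine (norm_sum_le _ _).trans ?_
  -- termwise: `‖B̄xy·Bxy′‖ = (e^{φ}‖Bxy‖)(e^{φ′}‖Bxy′‖)·e^{−(φ+φ′)} ≤ a_x b_x · e^{s − μ dc}`
  have hterm : ∀ x, ‖Bᴴ y x * B x y'‖ ≤ (Real.exp (φ y x) * ‖B x y‖) * (Real.exp (φ y' x) * ‖B x y'‖) * (Real.exp s * Real.exp (-(μ * dc y y'))) := by
    intro x
    rw [norm_mul, Matrix.conjTranspose_apply, norm_star]
    have hw : Real.exp s * Real.exp (-(μ * dc y y')) ≥ Real.exp (-(φ y x + φ y' x)) := by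
      rw [← Real.exp_add]; exact Real.exp_le_exp.mpr (by linarith [hφ y y' x])
    have hid : ‖B x y‖ * ‖B x y'‖ = (Real.exp (φ y x) * ‖B x y‖) * (Real.exp (φ y' x) * ‖B x y'‖) * Real.exp (-(φ y x + φ y' x)) := by
      have : Real.exp (φ y x) * Real.exp (φ y' x) * Real.exp (-(φ y x + φ y' x)) = 1 := by
        rw [← Real.exp_add, ← Real.exp_add]; simp
      calc ‖B x y‖ * ‖B x y'‖ = ‖B x y‖ * ‖B x y'‖ * (Real.exp (φ y x) * Real.exp (φ y' x) * Real.exp (-(φ y x + φ y' x))) := by rw [this, mul_one]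
        _ = _ := by ring
    rw [hid]
    exact mul_le_mul_of_nonneg_left hw (by positivity)
  refine (Finset.sum_le_sum fun x _ => hterm x).trans ?_
  rw [← Finset.sum_mul]
  have hcs : ∑ x, (Real.exp (φ y x) * ‖B x y‖) * (Real.exp (φ y' x) * ‖B x y'‖)
      ≤ Real.sqrt (∑ x, (Real.exp (φ y x) * ‖B x y‖) ^ 2) * Real.sqrt (∑ x, (Real.exp (φ y' x) * ‖B x y'‖) ^ 2) :=
    Real.sum_mul_le_sqrt_mul_sqrt _ _ _
  have ha : Real.sqrt (∑ x, (Real.exp (φ y x) * ‖B x y‖) ^ 2) ≤ CB := by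
    rw [← Real.sqrt_sq hCB]
    refine Real.sqrt_le_sqrt (le_trans (le_of_eq (Finset.sum_congr rfl fun x _ => by ring)) (hB y))
  have hb : Real.sqrt (∑ x, (Real.exp (φ y' x) * ‖B x y'‖) ^ 2) ≤ CB := by
    rw [← Real.sqrt_sq hCB]
    refine Real.sqrt_le_sqrt (le_trans (le_of_eq (Finset.sum_congr rfl fun x _ => by ring)) (hB y'))
  have hprod : ∑ x, (Real.exp (φ y x) * ‖B x y‖) * (Real.exp (φ y' x) * ‖B x y'‖) ≤ CB ^ 2 := by
    refine hcs.trans ?_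
    rw [sq]
    exact mul_le_mul ha hb (Real.sqrt_nonneg _) hCB
  calc (∑ x, (Real.exp (φ y x) * ‖B x y‖) * (Real.exp (φ y' x) * ‖B x y'‖)) * (Real.exp s * Real.exp (-(μ * dc y y')))
      ≤ CB ^ 2 * (Real.exp s * Real.exp (-(μ * dc y y'))) := mul_le_mul_of_nonneg_right hprod (by positivity)
    _ = CB ^ 2 * Real.exp s * Real.exp (-(μ * dc y y')) := by ring

/-! ## §2 Agmon for the Gram operator: the conjugate `M_φ = B̃₋ᴴ B̃₊` is accretive under `ε`-small column perturbations -/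

/-- **THE SANDWICH IDENTITY**: with `B̃₊ := e^{ψ}Be^{−φ}`, `B̃₋ := e^{−ψ}Be^{φ}` (fine weight `ψ`, coarse weight `φ`),
`Σ_a c̄_a ((M_φ) c)_a = Σ_x conj((B̃₋c)_x)·(B̃₊c)_x` for `M = BᴴB`, `(M_φ)_{ab} = e^{φ_a − φ_b} M_{ab}` — the fine weight cancels between the two factors.
[cite: Balaban1985BackgroundPropagators, (3.21) p.394] -/
theorem conj_gram_form_eq (B : Matrix n m ℂ) {M : Matrix m m ℂ} (hM : M = Bᴴ * B) (ψ : n → ℝ) (φ : m → ℝ) (c : m → ℂ) :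
    ∑ a, star (c a) * ((Matrix.of fun a b => (Real.exp (φ a - φ b) : ℂ) * M a b) *ᵥ c) a
      = ∑ x, star (((Matrix.of fun x b => (Real.exp (φ b - ψ x) : ℂ) * B x b) *ᵥ c) x)
          * ((Matrix.of fun x b => (Real.exp (ψ x - φ b) : ℂ) * B x b) *ᵥ c) x := by
  -- expand both sides into triple sums over `(a, b, x)` ∕ `(x, a, b)`
  have hL : ∑ a, star (c a) * ((Matrix.of fun a b => (Real.exp (φ a - φ b) : ℂ) * M a b) *ᵥ c) a
      = ∑ a, ∑ b, ∑ x, star (c a) * ((Real.exp (φ a - φ b) : ℂ) * (star (B x a) * B x b)) * c b := by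
    refine Finset.sum_congr rfl fun a _ => ?_
    rw [Matrix.mulVec, dotProduct, Finset.mul_sum]
    refine Finset.sum_congr rfl fun b _ => ?_
    rw [Matrix.of_apply, hM, Matrix.mul_apply, Finset.mul_sum, Finset.sum_mul, Finset.mul_sum]
    refine Finset.sum_congr rfl fun x _ => ?_
    rw [Matrix.conjTranspose_apply]; ring
  have hR : ∑ x, star (((Matrix.of fun x b => (Real.exp (φ b - ψ x) : ℂ) * B x b) *ᵥ c) x)
          * ((Matrix.of fun x b => (Real.exp (ψ x - φ b) : ℂ) * B x b) *ᵥ c) x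
      = ∑ x, ∑ a, ∑ b, star (c a) * ((Real.exp (φ a - φ b) : ℂ) * (star (B x a) * B x b)) * c b := by
    refine Finset.sum_congr rfl fun x _ => ?_
    rw [Matrix.mulVec, Matrix.mulVec, dotProduct, dotProduct, star_sum, Finset.sum_mul]
    refine Finset.sum_congr rfl fun a _ => ?_
    rw [Finset.mul_sum]
    refine Finset.sum_congr rfl fun b _ => ?_
    simp only [Matrix.of_apply, star_mul, Complex.star_def, Complex.conj_ofReal]
    have hexp : ((Real.exp (φ a - ψ x) : ℝ) : ℂ) * ((Real.exp (ψ x - φ b) : ℝ) : ℂ) = ((Real.exp (φ a - φ b) : ℝ) : ℂ) := by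
      rw [← Complex.ofReal_mul, ← Real.exp_add]; congr 1; ring_nf
    rw [← hexp]; ring
  rw [hL, hR]
  exact (Finset.sum_congr rfl fun a _ => Finset.sum_comm).trans Finset.sum_comm

omit [Fintype m] in
/-- ★ **QUADRATIC ABSORPTION**: `Re Σ conj(u_x + d₋_x)(u_x + d₊_x) ≥ ½·Σ‖u_x‖² − 3ε²` whenever `Σ‖d_±‖² ≤ ε²` (`2ab ≤ ½a² + 2b²`). [folklore] -/
theorem re_pairing_ge_of_perturbation (u dm dp : n → ℂ) {ε : ℝ} (hε : 0 ≤ ε)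
    (hdm : ∑ x, ‖dm x‖ ^ 2 ≤ ε ^ 2) (hdp : ∑ x, ‖dp x‖ ^ 2 ≤ ε ^ 2) :
    (1 / 2) * ∑ x, ‖u x‖ ^ 2 - 3 * ε ^ 2 ≤ (∑ x, star (u x + dm x) * (u x + dp x)).re := by
  -- split the pairing into four
  have hsplit : ∑ x, star (u x + dm x) * (u x + dp x)
      = ∑ x, star (u x) * u x + ∑ x, star (u x) * dp x + ∑ x, star (dm x) * u x + ∑ x, star (dm x) * dp x := by
    rw [← Finset.sum_add_distrib, ← Finset.sum_add_distrib, ← Finset.sum_add_distrib]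
    refine Finset.sum_congr rfl fun x _ => ?_
    rw [star_add]; ring
  rw [hsplit, Complex.add_re, Complex.add_re, Complex.add_re]
  -- the diagonal term
  have hdiag : (∑ x, star (u x) * u x).re = ∑ x, ‖u x‖ ^ 2 := by
    rw [Complex.re_sum]
    refine Finset.sum_congr rfl fun x _ => ?_
    rw [Complex.star_def, Complex.conj_mul', ← Complex.ofReal_pow, Complex.ofReal_re]
  -- the three cross terms by Cauchy–Schwarz
  set U := Real.sqrt (∑ x, ‖u x‖ ^ 2) with hU
  have hU0 : 0 ≤ U := Real.sqrt_nonneg _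
  have hUsq : U ^ 2 = ∑ x, ‖u x‖ ^ 2 := Real.sq_sqrt (Finset.sum_nonneg fun x _ => by positivity)
  have hDm : Real.sqrt (∑ x, ‖dm x‖ ^ 2) ≤ ε := by rw [← Real.sqrt_sq hε]; exact Real.sqrt_le_sqrt hdm
  have hDp : Real.sqrt (∑ x, ‖dp x‖ ^ 2) ≤ ε := by rw [← Real.sqrt_sq hε]; exact Real.sqrt_le_sqrt hdp
  have h1 : -(U * ε) ≤ (∑ x, star (u x) * dp x).re := by
    have h := re_sum_star_mul_le (fun x => -u x) dp
    have hneg : (∑ x, star ((fun x => -u x) x) * dp x).re = -(∑ x, star (u x) * dp x).re := by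
      rw [← Complex.neg_re, ← Finset.sum_neg_distrib]
      congr 1; refine Finset.sum_congr rfl fun x _ => ?_; rw [star_neg]; ring
    have hnorm : Real.sqrt (∑ x, ‖(fun x => -u x) x‖ ^ 2) = U := by simp only [norm_neg]; rfl
    rw [hneg, hnorm] at h
    nlinarith [mul_le_mul_of_nonneg_left hDp hU0]
  have h2 : -(ε * U) ≤ (∑ x, star (dm x) * u x).re := by
    have h := re_sum_star_mul_le (fun x => -dm x) u
    have hneg : (∑ x, star ((fun x => -dm x) x) * u x).re = -(∑ x, star (dm x) * u x).re := by
      rw [← Complex.neg_re, ← Finset.sum_neg_distrib]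
      congr 1; refine Finset.sum_congr rfl fun x _ => ?_; rw [star_neg]; ring
    have hnorm : Real.sqrt (∑ x, ‖(fun x => -dm x) x‖ ^ 2) = Real.sqrt (∑ x, ‖dm x‖ ^ 2) := by simp only [norm_neg]
    rw [hneg, hnorm] at h
    nlinarith [mul_le_mul_of_nonneg_right hDm hU0, Real.sqrt_nonneg (∑ x, ‖dm x‖ ^ 2)]
  have h3 : -(ε * ε) ≤ (∑ x, star (dm x) * dp x).re := by
    have h := re_sum_star_mul_le (fun x => -dm x) dp
    have hneg : (∑ x, star ((fun x => -dm x) x) * dp x).re = -(∑ x, star (dm x) * dp x).re := by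
      rw [← Complex.neg_re, ← Finset.sum_neg_distrib]
      congr 1; refine Finset.sum_congr rfl fun x _ => ?_; rw [star_neg]; ring
    have hnorm : Real.sqrt (∑ x, ‖(fun x => -dm x) x‖ ^ 2) = Real.sqrt (∑ x, ‖dm x‖ ^ 2) := by simp only [norm_neg]
    rw [hneg, hnorm] at h
    nlinarith [mul_le_mul hDm hDp (Real.sqrt_nonneg _) hε, Real.sqrt_nonneg (∑ x, ‖dm x‖ ^ 2), Real.sqrt_nonneg (∑ x, ‖dp x‖ ^ 2)]
  rw [hdiag, ← hUsq]
  -- `U² − 2εU − ε² ≥ ½U² − 3ε²`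
  nlinarith [sq_nonneg (U - 2 * ε)]

/-- ★★ **CONJUGATE ACCRETIVITY OF THE GRAM OPERATOR** (Agmon for `M = BᴴB` on the coarse lattice): if `B` is `m₀`-coercive (`m₀·Σ‖c‖² ≤ Σ‖(Bc)_x‖²`) and the two weighted
column operators `B̃₊ = e^{ψ}Be^{−φ}`, `B̃₋ = e^{−ψ}Be^{φ}` are `ε`-close to `B` (`Σ_x‖((B̃_± − B)c)_x‖² ≤ ε²·Σ‖c‖²`), then
`(m₀∕2 − 3ε²)·Σ‖c_a‖² ≤ Re Σ_a c̄_a ((M_φ)c)_a` with `(M_φ)_{ab} = e^{φ_a − φ_b}M_{ab}` — the `hconj` row of ✓`weighted_sum_normSq_inv_mulVec_le_of_conj_accretive`.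
[cite: Balaban1985BackgroundPropagators, Thm 3.1 (3.46) p.398; Balaban1988RG2Cluster, (2.7) p.13] -/
theorem re_conj_gram_ge (B : Matrix n m ℂ) {M : Matrix m m ℂ} (hM : M = Bᴴ * B) (ψ : n → ℝ) (φ : m → ℝ) {m₀ ε : ℝ} (hε : 0 ≤ ε)
    (hcoer : ∀ c : m → ℂ, m₀ * ∑ y, ‖c y‖ ^ 2 ≤ ∑ x, ‖(B *ᵥ c) x‖ ^ 2)
    (hplus : ∀ c : m → ℂ, ∑ x, ‖((Matrix.of fun x b => (Real.exp (ψ x - φ b) : ℂ) * B x b) *ᵥ c) x - (B *ᵥ c) x‖ ^ 2 ≤ ε ^ 2 * ∑ y, ‖c y‖ ^ 2)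
    (hminus : ∀ c : m → ℂ, ∑ x, ‖((Matrix.of fun x b => (Real.exp (φ b - ψ x) : ℂ) * B x b) *ᵥ c) x - (B *ᵥ c) x‖ ^ 2 ≤ ε ^ 2 * ∑ y, ‖c y‖ ^ 2)
    (c : m → ℂ) :
    (m₀ / 2 - 3 * ε ^ 2) * ∑ y, ‖c y‖ ^ 2 ≤ (∑ a, star (c a) * ((Matrix.of fun a b => (Real.exp (φ a - φ b) : ℂ) * M a b) *ᵥ c) a).re := by
  rw [conj_gram_form_eq B hM ψ φ c]
  set u : n → ℂ := B *ᵥ c with hu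
  set dp : n → ℂ := fun x => ((Matrix.of fun x b => (Real.exp (ψ x - φ b) : ℂ) * B x b) *ᵥ c) x - u x with hdp
  set dm : n → ℂ := fun x => ((Matrix.of fun x b => (Real.exp (φ b - ψ x) : ℂ) * B x b) *ᵥ c) x - u x with hdm
  have hC0 : 0 ≤ ∑ y, ‖c y‖ ^ 2 := Finset.sum_nonneg fun y _ => by positivity
  -- normalise: `ε' := ε·‖c‖`
  set ε' : ℝ := ε * Real.sqrt (∑ y, ‖c y‖ ^ 2) with hε'
  have hε'0 : 0 ≤ ε' := mul_nonneg hε (Real.sqrt_nonneg _)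
  have hε'sq : ε' ^ 2 = ε ^ 2 * ∑ y, ‖c y‖ ^ 2 := by rw [hε', mul_pow, Real.sq_sqrt hC0]
  have hdm' : ∑ x, ‖dm x‖ ^ 2 ≤ ε' ^ 2 := by rw [hε'sq]; exact hminus c
  have hdp' : ∑ x, ‖dp x‖ ^ 2 ≤ ε' ^ 2 := by rw [hε'sq]; exact hplus c
  have hrw : ∑ x, star (((Matrix.of fun x b => (Real.exp (φ b - ψ x) : ℂ) * B x b) *ᵥ c) x)
        * ((Matrix.of fun x b => (Real.exp (ψ x - φ b) : ℂ) * B x b) *ᵥ c) x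
      = ∑ x, star (u x + dm x) * (u x + dp x) := by
    refine Finset.sum_congr rfl fun x _ => ?_
    simp only [hdm, hdp, add_sub_cancel]
  rw [hrw]
  have h := re_pairing_ge_of_perturbation u dm dp hε'0 hdm' hdp'
  have hco := hcoer c
  rw [hε'sq] at h
  nlinarith [h, hco]

/-! ## §3 The decaying inverse of the Gram operator -/

/-- ★★ **AGMON DECAY OF `M⁻¹` ON THE COARSE LATTICE**: `m₀`-coercive `B` (`m₀ > 0`) and `ε`-small weighted column perturbations with `3ε² < m₀∕2` ⟹
`Σ_y e^{2φ_y}‖(M⁻¹v)_y‖² ≤ (m₀∕2 − 3ε²)⁻²·Σ_y e^{2φ_y}‖v_y‖²`. [cite: Balaban1985BackgroundPropagators, Thm 3.1 (3.46) p.398; Balaban1988RG2Cluster, (2.7) p.13] -/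
theorem gram_inv_weighted_decay [DecidableEq m] (B : Matrix n m ℂ) {M : Matrix m m ℂ} (hM : M = Bᴴ * B) (ψ : n → ℝ) (φ : m → ℝ) {m₀ ε : ℝ}
    (hm₀ : 0 < m₀) (hε : 0 ≤ ε) (hgap : 3 * ε ^ 2 < m₀ / 2)
    (hcoer : ∀ c : m → ℂ, m₀ * ∑ y, ‖c y‖ ^ 2 ≤ ∑ x, ‖(B *ᵥ c) x‖ ^ 2)
    (hplus : ∀ c : m → ℂ, ∑ x, ‖((Matrix.of fun x b => (Real.exp (ψ x - φ b) : ℂ) * B x b) *ᵥ c) x - (B *ᵥ c) x‖ ^ 2 ≤ ε ^ 2 * ∑ y, ‖c y‖ ^ 2)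
    (hminus : ∀ c : m → ℂ, ∑ x, ‖((Matrix.of fun x b => (Real.exp (φ b - ψ x) : ℂ) * B x b) *ᵥ c) x - (B *ᵥ c) x‖ ^ 2 ≤ ε ^ 2 * ∑ y, ‖c y‖ ^ 2)
    (v : m → ℂ) :
    ∑ y, Real.exp (φ y) ^ 2 * ‖(M⁻¹ *ᵥ v) y‖ ^ 2 ≤ (m₀ / 2 - 3 * ε ^ 2)⁻¹ ^ 2 * ∑ y, Real.exp (φ y) ^ 2 * ‖v y‖ ^ 2 :=
  weighted_sum_normSq_inv_mulVec_le_of_conj_accretive M φ hm₀ (by linarith)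
    (accretive_gram_of_coercive B hM hcoer) (re_conj_gram_ge B hM ψ φ hε hcoer hplus hminus) v

/-- ★ **ENTRY FORM**: under the same hypotheses with `φ y′ = 0` at the source, `‖M⁻¹ y y′‖ ≤ (m₀∕2 − 3ε²)⁻¹·e^{−φ_y}` — the `hN`∕`hMinv` input of ✓`norm_form_sandwich_le_exp` ∕
✓`P_decay` once `φ = μ″·dc(·, y′)`. [cite: Balaban1985BackgroundPropagators, (3.49) p.399] -/
theorem gram_inv_entry_decay [DecidableEq m] (B : Matrix n m ℂ) {M : Matrix m m ℂ} (hM : M = Bᴴ * B) (ψ : n → ℝ) (φ : m → ℝ) {m₀ ε : ℝ}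
    (hm₀ : 0 < m₀) (hε : 0 ≤ ε) (hgap : 3 * ε ^ 2 < m₀ / 2)
    (hcoer : ∀ c : m → ℂ, m₀ * ∑ y, ‖c y‖ ^ 2 ≤ ∑ x, ‖(B *ᵥ c) x‖ ^ 2)
    (hplus : ∀ c : m → ℂ, ∑ x, ‖((Matrix.of fun x b => (Real.exp (ψ x - φ b) : ℂ) * B x b) *ᵥ c) x - (B *ᵥ c) x‖ ^ 2 ≤ ε ^ 2 * ∑ y, ‖c y‖ ^ 2)
    (hminus : ∀ c : m → ℂ, ∑ x, ‖((Matrix.of fun x b => (Real.exp (φ b - ψ x) : ℂ) * B x b) *ᵥ c) x - (B *ᵥ c) x‖ ^ 2 ≤ ε ^ 2 * ∑ y, ‖c y‖ ^ 2)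
    (y y' : m) (hy' : φ y' = 0) :
    ‖M⁻¹ y y'‖ ≤ (m₀ / 2 - 3 * ε ^ 2)⁻¹ * Real.exp (-(φ y)) := by
  have hm' : 0 < m₀ / 2 - 3 * ε ^ 2 := by linarith
  have hset := set_decay_of_conj_accretive M φ hm₀ hm' (accretive_gram_of_coercive B hM hcoer) (re_conj_gram_ge B hM ψ φ hε hcoer hplus hminus)
    (Pi.single y' 1) (fun i hi => by
      by_cases h : i = y'
      · rw [h]; exact hy'
      · exact absurd (by simp [h]) hi) {y} (fun i hi => by rw [Finset.mem_singleton.mp hi])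
  rw [Finset.sum_singleton] at hset
  have hcol : (M⁻¹ *ᵥ Pi.single y' 1) y = M⁻¹ y y' := by simp [Matrix.mulVec, dotProduct, Pi.single_apply]
  have hsrc : ∑ i, ‖(Pi.single y' (1 : ℂ) : m → ℂ) i‖ ^ 2 = 1 := by
    rw [Finset.sum_eq_single y']
    · simp
    · intro b _ hb; simp [hb]
    · intro h; exact absurd (Finset.mem_univ _) h
  rw [hcol, hsrc, mul_one] at hset
  have hnn : 0 ≤ (m₀ / 2 - 3 * ε ^ 2)⁻¹ * Real.exp (-(φ y)) := by positivity
  have hsq : ‖M⁻¹ y y'‖ ^ 2 ≤ ((m₀ / 2 - 3 * ε ^ 2)⁻¹ * Real.exp (-(φ y))) ^ 2 := by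
    calc ‖M⁻¹ y y'‖ ^ 2 ≤ Real.exp (-φ y) ^ 2 * (m₀ / 2 - 3 * ε ^ 2)⁻¹ ^ 2 := hset
      _ = ((m₀ / 2 - 3 * ε ^ 2)⁻¹ * Real.exp (-(φ y))) ^ 2 := by ring
  exact (pow_le_pow_iff_left₀ (norm_nonneg _) hnn two_ne_zero).mp hsq

end Summit.QuantumFields.YangMills.Theorems.Prop7GramConjAccretive

end
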